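import Summits.CriticalPhenomena.PercolationContinuityZ3.Theorems.PercNearOneGluingNoHeavyLowerTailSahiSliceMinimumGradient
import Summits.CriticalPhenomena.PercolationContinuityZ3.Theorems.SahiMasterFamilyLift
import Mathlib.Analysis.Calculus.LocalExtr.Basic
import Mathlib.Topology.Order.Compact

/-!
# `NoHeavyLowerTail` (crux stmt-CriticalPhenomena-4575), Sahi programme P2 (gen 17): KAHN'S CONJECTURE 5 FOLLOWS FROM A STATEMENT
# ABOUT CRITICAL POINTS — "the polynomial `p ↦ E₃(μ_p)` has no axiswise interior local minimum"

Support file (`--supports stmt-CriticalPhenomena-4575`; companion of `…SahiSliceMinimum`, `…SahiSliceMinimumBlowup`,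
`…SahiSliceMinimumGradient`).  Nothing here asserts Kahn's or Sahi's conjecture: the critical-point statement is TYPED (`@[conjecture]`)
and the file proves the REDUCTION.

THE STATEMENT (`NoInteriorAxisMinimum`, "NIM"; new).  For a product measure `μ_p` with a live coin and three increasing events, write
`G(q) = E₃(μ_q; 1_U)` and, for a live coin `e`, `Φ_e(s) = G(p[e↦s])` (the fibre cubic `cubicE3`).  NIM: **if every live fibre is
stationary at the actual bias (`Φ_e′(p_e) = 0` for all live `e`), then some live fibre is not strictly convex there (`Φ_e″(p_e) ≤ 0`).**
Equivalently: no interior critical point of `G` (in the live coordinates) has all axial second derivatives positive.  It is a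
consequence of the slice minimum principle on all cubes (compose with large threshold blocks, memo §1) and holds in every census
(m ≤ 7, ≈ 7,600 interior critical points found by Newton iteration: all maxima or saddles, indeed `min_e Φ_e″ ≤ −1.4·G`).

THE REDUCTION (`masterFamilyNonneg_three_of_noInteriorAxisMinimum`, proved here): **NIM ⟹ `MasterFamilyNonneg 3`** (Kahn's Conjecture 5,
`kahnConjecture_of_noInteriorAxisMinimum`; Sahi's `C₃`, `sahiConjecture_three_of_noInteriorAxisMinimum`).  Proof = the minimal-counterexample
argument made constructive: induct on the number of live coins; minimise `G` over the compact sub-cube of bias vectors agreeing with `p` off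
the live set (`exists_min_subcube`); at a minimiser either a live coin froze (induction) or every live fibre has an interior minimum, hence is
stationary (Fermat, `IsLocalMin.hasDerivAt_eq_zero` with `hasDerivAt_cubicE3`); NIM gives a live `e` with `Φ_e″ ≤ 0`; but a fibre cubic with
nonnegative cubic coefficient (product of three influences), stationary and non-convex at an interior point which minimises it over `[0,1]`,
is FLAT down to the bottom facet (`cubicE3_zero_eq_of_min`: `Φ(0) = Φ(s) + ½s²Φ″(s) − s³c₃ ≤ Φ(s) ≤ Φ(0)`), so freezing `e` at `0` keeps the
minimum value and loses a live coin — induction again.  HONEST LABEL: a reduction; `C₃` remains OPEN. [this work]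
-/

noncomputable section

open scoped Classical Topology

namespace Summit.CriticalPhenomena.PercolationContinuityZ3.Theorems

open Finset Function Filter
open Literature.Combinatorics.Sahi2008
open Literature.Probability.Percolation.DecisionTree (ind ind_of_mem ind_of_not_mem ind_nonneg)

namespace SahiSliceMinimum

variable {ι : Type} [Fintype ι]

/-! ### The statement (typed) -/

/-- **NO INTERIOR AXISWISE MINIMUM (NIM)** (this seat, gen 17): for every finite `ι`, every `p : ι → [0,1]` with a live coin and every
three increasing events, if `∂E₃/∂p_e = 0` for every live coin `e` then `∂²E₃/∂p_e² ≤ 0` for some live coin `e` — the polynomial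
`p ↦ E₃(μ_p; 1_U)` has no interior critical point (in its live coordinates) at which every axial second derivative is positive.  A
consequence of `SliceMinimumPrinciple 3` on all cubes (threshold blow-up, on paper); census-clean.  An obligation / hypothesis; never
import it as a fact. [this work] [status: open; conjecture] -/
@[conjecture] def NoInteriorAxisMinimum : Prop :=
  ∀ (ι : Type) [Fintype ι] (p : ι → unitInterval) (U : Fin 3 → Set (Set ι)),
    (∀ j, IsUpperSet (U j)) → (liveSet p).Nonempty →
      (∀ e ∈ liveSet p, fibreSlope p e (ind (U 0)) (ind (U 1)) (ind (U 2)) = 0) →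
        ∃ e ∈ liveSet p, cubicE3Deriv2 p e (ind (U 0)) (ind (U 1)) (ind (U 2)) (p e) ≤ 0

/-! ### One-variable lemma: a stationary, non-convex interior minimum of a fibre cubic is flat down to the bottom facet -/

/-- **Flatness lemma.**  If the fibre cubic has `c₃ = Δf·Δg·Δh ≥ 0`, is stationary (`Φ′(s) = 0`) and not strictly convex
(`Φ″(s) ≤ 0`) at some `s > 0`, and `Φ(0) ≥ Φ(s)`, then `Φ(0) = Φ(s)` (Taylor: `Φ(0) = Φ(s) + ½s²Φ″(s) − s³c₃`). [this work] -/
theorem cubicE3_zero_eq_of_min (p : ι → unitInterval) (e : ι) (f g h : Set ι → ℝ) {s : ℝ} (hs : 0 < s)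
    (hc3 : 0 ≤ secDelta p e f * secDelta p e g * secDelta p e h) (hD1 : cubicE3Deriv p e f g h s = 0)
    (hD2 : cubicE3Deriv2 p e f g h s ≤ 0) (h0 : cubicE3 p e f g h s ≤ cubicE3 p e f g h 0) :
    cubicE3 p e f g h 0 = cubicE3 p e f g h s := by
  have hT := cubicE3_zero_taylor p e f g h s
  rw [hD1] at hT
  have h2 : s ^ 2 / 2 * cubicE3Deriv2 p e f g h s ≤ 0 := mul_nonpos_of_nonneg_of_nonpos (by positivity) hD2
  have h3 : 0 ≤ s ^ 3 * (secDelta p e f * secDelta p e g * secDelta p e h) := mul_nonneg (pow_nonneg hs.le 3) hc3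
  linarith

/-- The cubic coefficient of the fibre of three INCREASING events is nonnegative (product of three influences). [folklore] -/
theorem secDelta_prod_nonneg_of_isUpperSet (p : ι → unitInterval) (e : ι) {U : Fin 3 → Set (Set ι)} (hU : ∀ j, IsUpperSet (U j)) :
    0 ≤ secDelta p e (ind (U 0)) * secDelta p e (ind (U 1)) * secDelta p e (ind (U 2)) :=
  mul_nonneg (mul_nonneg (sub_nonneg.2 (secEx_ind_mono p e (hU 0))) (sub_nonneg.2 (secEx_ind_mono p e (hU 1))))
    (sub_nonneg.2 (secEx_ind_mono p e (hU 2)))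

/-! ### Minimising `E₃` over the sub-cube of a prescribed live set -/

/-- `E₃(μ_q; 1_U)` as a function of the bias vector. [this work] -/
def G3 (U : Fin 3 → Set (Set ι)) (q : ι → unitInterval) : ℝ := sahiE (bernoulliWeight q) 3 (fun j => ind (U j))

/-- `G3` is continuous in the bias vector. [this work] -/
theorem continuous_G3 (U : Fin 3 → Set (Set ι)) : Continuous (G3 (ι := ι) U) :=
  continuous_sahiE_bernoulliWeight 3 _

omit [Fintype ι] in
/-- The family `fun j => 1_{U j}` as a `![…]` triple. [folklore] -/
theorem ind_family_eq (U : Fin 3 → Set (Set ι)) : (fun j => ind (U j)) = ![ind (U 0), ind (U 1), ind (U 2)] := by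
  funext j; fin_cases j <;> rfl

/-- `G3` along one coin is the fibre cubic. [this work] -/
theorem G3_update_eq (U : Fin 3 → Set (Set ι)) (q : ι → unitInterval) (e : ι) (s : unitInterval) :
    G3 U (update q e s) = cubicE3 q e (ind (U 0)) (ind (U 1)) (ind (U 2)) (s : ℝ) := by
  unfold G3
  rw [ind_family_eq, sahiE_three_update_eq]

/-- The sub-cube of bias vectors that agree with `p` outside the set `L`. [this work] -/
def subcube (p : ι → unitInterval) (L : Finset ι) : Set (ι → unitInterval) := {q | ∀ i, i ∉ L → q i = p i}

/-- The sub-cube is compact. [this work] -/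
theorem isCompact_subcube (p : ι → unitInterval) (L : Finset ι) : IsCompact (subcube p L) := by
  have hclosed : IsClosed (subcube p L) := by
    have : subcube p L = ⋂ i ∈ (Lᶜ : Finset ι), {q : ι → unitInterval | q i = p i} := by
      ext q
      simp only [subcube, Set.mem_setOf_eq, Set.mem_iInter, Finset.mem_compl]
    rw [this]
    exact isClosed_biInter fun i _ => isClosed_eq (continuous_apply i) continuous_const
  exact hclosed.isCompact

omit [Fintype ι] in
/-- `p` itself lies in its sub-cube. [this work] -/
theorem mem_subcube_self (p : ι → unitInterval) (L : Finset ι) : p ∈ subcube p L := fun _ _ => rfl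

omit [Fintype ι] in
/-- Updating a coordinate inside `L` stays in the sub-cube. [this work] -/
theorem update_mem_subcube {p : ι → unitInterval} {L : Finset ι} {q : ι → unitInterval} (hq : q ∈ subcube p L) {e : ι}
    (he : e ∈ L) (s : unitInterval) : update q e s ∈ subcube p L := by
  intro i hi
  have hie : i ≠ e := fun h => hi (h ▸ he)
  rw [update_of_ne hie]
  exact hq i hi

/-- The live set of a point of the sub-cube of `liveSet p` is contained in `liveSet p`. [this work] -/
theorem liveSet_subset_of_mem_subcube {p q : ι → unitInterval} (hq : q ∈ subcube p (liveSet p)) : liveSet q ⊆ liveSet p := by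
  intro i hi
  by_contra hni
  have hqi : q i = p i := hq i hni
  rw [mem_liveSet] at hi hni
  rw [hqi] at hi
  exact hni hi

/-- **A minimiser of `G3` over the sub-cube exists** (compactness + continuity). [this work] -/
theorem exists_min_subcube (U : Fin 3 → Set (Set ι)) (p : ι → unitInterval) :
    ∃ q ∈ subcube p (liveSet p), ∀ q' ∈ subcube p (liveSet p), G3 U q ≤ G3 U q' := by
  obtain ⟨q, hq, hmin⟩ := (isCompact_subcube p (liveSet p)).exists_isMinOn ⟨p, mem_subcube_self p _⟩
    (continuous_G3 U).continuousOn
  exact ⟨q, hq, fun q' hq' => hmin hq'⟩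

/-! ### Fermat: at an interior minimiser every live fibre is stationary -/

/-- If `q` minimises `G3` over the sub-cube and `e` is a live coin of `q` inside the live set of `p`, the fibre along `e` is stationary
at `q_e`. [this work] -/
theorem fibreSlope_eq_zero_of_min {U : Fin 3 → Set (Set ι)} {p q : ι → unitInterval} (hq : q ∈ subcube p (liveSet p))
    (hmin : ∀ q' ∈ subcube p (liveSet p), G3 U q ≤ G3 U q') {e : ι} (he : e ∈ liveSet p) (hqe : e ∈ liveSet q) :
    fibreSlope q e (ind (U 0)) (ind (U 1)) (ind (U 2)) = 0 := by
  rw [fibreSlope_eq]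
  have hqe' := (mem_liveSet q e).1 hqe
  -- the fibre cubic has a local minimum at `q e`
  have hloc : IsLocalMin (cubicE3 q e (ind (U 0)) (ind (U 1)) (ind (U 2))) (q e : ℝ) := by
    have hnhds : Set.Ioo (0 : ℝ) 1 ∈ 𝓝 (q e : ℝ) := Ioo_mem_nhds hqe'.1 hqe'.2
    refine Filter.eventually_of_mem hnhds fun t ht => ?_
    have ht' : t ∈ Set.Icc (0 : ℝ) 1 := ⟨ht.1.le, ht.2.le⟩
    have h1 := hmin (update q e ⟨t, ht'⟩) (update_mem_subcube hq he _)
    have hself : G3 U q = cubicE3 q e (ind (U 0)) (ind (U 1)) (ind (U 2)) (q e : ℝ) := by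
      conv_lhs => rw [← update_eq_self e q]
      exact G3_update_eq U q e (q e)
    rw [G3_update_eq] at h1
    rw [hself] at h1
    exact h1
  exact hloc.hasDerivAt_eq_zero (hasDerivAt_cubicE3 q e _ _ _ _)

/-! ### The reduction -/

/-- **NIM implies the master family inequality of order 3** (`E₃ ≥ 0` for three increasing events under every product measure).
[this work] -/
theorem masterFamilyNonneg_three_of_noInteriorAxisMinimum (hNIM : NoInteriorAxisMinimum) : MasterFamilyNonneg 3 := by
  intro ι _ p U hU
  -- strong induction on the number of live coins, for all bias vectors at once
  suffices H : ∀ (c : ℕ) (q : ι → unitInterval), (liveSet q).card = c → 0 ≤ G3 U q from H _ p rfl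
  intro c
  induction c using Nat.strong_induction_on with
  | _ c ih =>
    intro p hc
    by_cases hlive : (liveSet p).Nonempty
    swap
    · -- no live coin: point mass, `E₃ = 0`
      have hfrozen : ∀ e, (p e : ℝ) = 0 ∨ (p e : ℝ) = 1 := fun e =>
        eq_zero_or_eq_one_of_not_live p e fun hl => hlive ⟨e, (mem_liveSet p e).2 hl⟩
      show 0 ≤ sahiE (bernoulliWeight p) 3 (fun j => ind (U j))
      rw [sahiE_eq_zero_of_frozen p hfrozen 1]
    -- minimise over the sub-cube of `liveSet p`
    obtain ⟨q, hq, hmin⟩ := exists_min_subcube U p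
    have hpq : G3 U q ≤ G3 U p := hmin p (mem_subcube_self p _)
    suffices hq0 : 0 ≤ G3 U q from le_trans hq0 hpq
    have hsub : liveSet q ⊆ liveSet p := liveSet_subset_of_mem_subcube hq
    by_cases hstrict : liveSet q = liveSet p
    swap
    · -- a live coin froze: fewer live coins, induction
      have hlt : (liveSet q).card < c := by
        rw [← hc]
        exact Finset.card_lt_card (Finset.ssubset_iff_subset_ne.2 ⟨hsub, hstrict⟩)
      exact ih _ hlt q rfl
    -- every live coin of `p` is live for `q`: all live fibres are stationary at `q`
    have hliveq : (liveSet q).Nonempty := by rw [hstrict]; exact hlive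
    have hstat : ∀ e ∈ liveSet q, fibreSlope q e (ind (U 0)) (ind (U 1)) (ind (U 2)) = 0 :=
      fun e he => fibreSlope_eq_zero_of_min hq hmin (hsub he) he
    obtain ⟨e, he, hD2⟩ := hNIM ι q U hU hliveq hstat
    -- the fibre along `e` is flat down to the bottom facet
    have hqe := (mem_liveSet q e).1 he
    have hD1 : cubicE3Deriv q e (ind (U 0)) (ind (U 1)) (ind (U 2)) (q e) = 0 := by
      rw [← fibreSlope_eq]; exact hstat e he
    have h0mem : update q e 0 ∈ subcube p (liveSet p) := update_mem_subcube hq (hsub he) 0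
    have h0ge : cubicE3 q e (ind (U 0)) (ind (U 1)) (ind (U 2)) (q e) ≤ cubicE3 q e (ind (U 0)) (ind (U 1)) (ind (U 2)) 0 := by
      have h1 := hmin (update q e 0) h0mem
      rw [G3_update_eq] at h1
      have hself : G3 U q = cubicE3 q e (ind (U 0)) (ind (U 1)) (ind (U 2)) (q e : ℝ) := by
        conv_lhs => rw [← update_eq_self e q]
        exact G3_update_eq U q e (q e)
      rw [hself] at h1
      simpa using h1
    have hflat := cubicE3_zero_eq_of_min q e (ind (U 0)) (ind (U 1)) (ind (U 2)) hqe.1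
      (secDelta_prod_nonneg_of_isUpperSet q e hU) hD1 hD2 h0ge
    -- so freezing `e` at `0` keeps the value and loses a live coin
    have hval : G3 U (update q e 0) = G3 U q := by
      rw [G3_update_eq]
      conv_rhs => rw [← update_eq_self e q, G3_update_eq]
      simpa using hflat
    have hlt : (liveSet (update q e 0)).card < c := by
      have h := card_liveSet_update_lt q he 0 (Or.inl Set.Icc.coe_zero)
      rw [hstrict, hc] at h
      exact h
    rw [← hval]
    exact ih _ hlt (update q e 0) rfl

/-- **NIM implies Kahn's Conjecture 5.** [this work] -/
theorem kahnConjecture_of_noInteriorAxisMinimum (h : NoInteriorAxisMinimum) : KahnConjecture :=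
  masterFamilyNonneg_three_iff_kahnConjecture.1 (masterFamilyNonneg_three_of_noInteriorAxisMinimum h)

/-- **NIM implies Sahi's `C₃`** for every FKG measure on every finite distributive lattice. [this work] -/
theorem sahiConjecture_three_of_noInteriorAxisMinimum (h : NoInteriorAxisMinimum) : SahiConjecture 3 :=
  sahiConjecture_three_iff_kahnConjecture.2 (kahnConjecture_of_noInteriorAxisMinimum h)

/-! ### A proved family: diagonal triples have concave fibres at every coin -/

/-- **NIM holds — with room and without the stationarity hypothesis — for diagonal triples `(U,U,U)`**: every fibre is concave
(`Φ″_e(s) = 6Δ²(m(s) − 1) ≤ 0`), at every coin and every bias. [this work] -/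
theorem cubicE3Deriv2_diag_nonpos (p : ι → unitInterval) (e : ι) (U : Set (Set ι)) (s : unitInterval) :
    cubicE3Deriv2 p e (ind U) (ind U) (ind U) (s : ℝ) ≤ 0 := by
  rw [cubicE3Deriv2_diag]
  have hm : secM p e (ind U) (s : ℝ) ≤ 1 := by
    have h1 := (secEx_ind_mem p e U true).2
    have h0 := (secEx_ind_mem p e U false).2
    have hs0 : 0 ≤ (s : ℝ) := s.2.1
    have hs1 : (s : ℝ) ≤ 1 := s.2.2
    unfold secM
    nlinarith
  exact mul_nonpos_of_nonneg_of_nonpos (by positivity) (by linarith)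

/-- The NIM conclusion for a diagonal triple at any live coin. [this work] -/
theorem nim_diag (p : ι → unitInterval) (U : Set (Set ι)) (hlive : (liveSet p).Nonempty) :
    ∃ e ∈ liveSet p, cubicE3Deriv2 p e (ind U) (ind U) (ind U) (p e) ≤ 0 := by
  obtain ⟨e, he⟩ := hlive
  exact ⟨e, he, cubicE3Deriv2_diag_nonpos p e U (p e)⟩

/-! ### A proved family: pair triples `(U,U,V)` — every stationary point of every fibre is a local maximum (appended, gen 17)

For `(U,U,V)` the fibre data satisfy a PER-COORDINATE IDENTITY (`u = m_U(s)`, `v = m_V(s)`, `w = m_{UV}(s)`, `Δ_U, Δ_V` the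
influences): `(1−u)·½Φ″(s) + Δ_U·Φ′(s) + Δ_U²·(2w − uv) + (1−u)²·Δ_UΔ_V = 0`.  Summed with the weights `q_e(1−q_e)` it says that
`E₃` of a pair triple is a SUPERSOLUTION with an explicit drift along the influence vector of `U`:
`Σ_e q_e(1−q_e)[∂²_eG + (2I_e(U)/(1−u))∂_eG] = −2W¹[U]·G/(1−u)² − 2(1−u)·Cov¹(U,V) ≤ 0` (`W¹`, `Cov¹` = level-1 Fourier weight / covariance).
Consequence: wherever a fibre is stationary it is concave — NIM holds at EVERY live coin of a pair triple. -/

/-- `Φ″` of a pair triple has the factor `Δ_U`. [this work] -/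
theorem cubicE3Deriv2_pair_eq (p : ι → unitInterval) (e : ι) (U V : Set (Set ι)) (s : ℝ) :
    cubicE3Deriv2 p e (ind U) (ind U) (ind V) s =
      2 * secDelta p e (ind U) * (2 * secM p e (ind U) s * secDelta p e (ind V) + secM p e (ind V) s * secDelta p e (ind U) -
        2 * secDelta p e (ind U * ind V) - secDelta p e (ind V)) := by
  have h2 : ind U * ind U = ind U := ind_mul_self U
  simp only [cubicE3Deriv2, h2, secM, secDelta]
  ring

/-- **The per-coordinate identity of the pair family**:
`(1−u)·Φ″ + 2Δ_U·Φ′ + 2Δ_U²(2w − uv) + 2(1−u)²Δ_UΔ_V = 0`. [this work] -/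
theorem pair_fibre_identity (p : ι → unitInterval) (e : ι) (U V : Set (Set ι)) (s : ℝ) :
    (1 - secM p e (ind U) s) * cubicE3Deriv2 p e (ind U) (ind U) (ind V) s +
        2 * secDelta p e (ind U) * cubicE3Deriv p e (ind U) (ind U) (ind V) s +
        2 * secDelta p e (ind U) ^ 2 * (2 * secM p e (ind U * ind V) s - secM p e (ind U) s * secM p e (ind V) s) +
        2 * (1 - secM p e (ind U) s) ^ 2 * (secDelta p e (ind U) * secDelta p e (ind V)) = 0 := by
  have h2 : ind U * ind U = ind U := ind_mul_self U
  simp only [cubicE3Deriv, cubicE3Deriv2, h2, secM, secDelta]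
  ring

/-- Harris at bias `s`: `m_U(s)·m_V(s) ≤ m_{UV}(s)` (the moments at bias `s` are the expectations under `μ_{p[e↦s]}`). [folklore] -/
theorem secM_harris (p : ι → unitInterval) (e : ι) {U V : Set (Set ι)} (hU : IsUpperSet U) (hV : IsUpperSet V) (s : unitInterval) :
    secM p e (ind U) s * secM p e (ind V) s ≤ secM p e (ind U * ind V) s := by
  have hM : ∀ k : Set ι → ℝ, secM p e k s = ex (bernoulliWeight (update p e s)) k := by
    intro k; rw [ex_update_eq]; unfold secM; ring
  rw [hM, hM, hM]
  have h2 := masterFamilyNonneg_of_sliceMinimumPrinciple sliceMinimumPrinciple_two ι (update p e s) ![U, V]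
    (by intro j; fin_cases j <;> assumption)
  have hf : (fun j => ind ((![U, V] : Fin 2 → Set (Set ι)) j)) = ![ind U, ind V] := by
    funext j; fin_cases j <;> rfl
  rw [hf, sahiE_two] at h2
  linarith

/-- **Pair triples: a stationary fibre point is never a strict local minimum** — if `Φ′_e(s) = 0` at some `s < 1` then `Φ″_e(s) ≤ 0`,
for `(1_U,1_U,1_V)` with `U, V` increasing, at EVERY coin `e`. [this work] -/
theorem cubicE3Deriv2_nonpos_of_stationary_pair (p : ι → unitInterval) (e : ι) {U V : Set (Set ι)} (hU : IsUpperSet U)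
    (hV : IsUpperSet V) (s : unitInterval) (hs : (s : ℝ) < 1) (h0 : cubicE3Deriv p e (ind U) (ind U) (ind V) s = 0) :
    cubicE3Deriv2 p e (ind U) (ind U) (ind V) s ≤ 0 := by
  have hΔU : 0 ≤ secDelta p e (ind U) := sub_nonneg.2 (secEx_ind_mono p e hU)
  have hΔV : 0 ≤ secDelta p e (ind V) := sub_nonneg.2 (secEx_ind_mono p e hV)
  have hH := secM_harris p e hU hV s
  have hid := pair_fibre_identity p e U V s
  rw [h0, mul_zero, add_zero] at hid
  obtain ⟨h00, h01⟩ := secEx_ind_mem p e U false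
  obtain ⟨h10, h11⟩ := secEx_ind_mem p e U true
  obtain ⟨v00, v01⟩ := secEx_ind_mem p e V false
  obtain ⟨v10, v11⟩ := secEx_ind_mem p e V true
  have hs0 : 0 ≤ (s : ℝ) := s.2.1
  have hu1 : secM p e (ind U) s ≤ 1 := by unfold secM; nlinarith
  have hv0 : 0 ≤ secM p e (ind V) s := by unfold secM; nlinarith
  have huv : 0 ≤ 2 * secM p e (ind U * ind V) s - secM p e (ind U) s * secM p e (ind V) s := by
    have hu0 : 0 ≤ secM p e (ind U) s := by unfold secM; nlinarith
    nlinarith [mul_nonneg hu0 hv0]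
  rcases eq_or_lt_of_le hΔU with hz | hpos
  · -- `Δ_U = 0`: `Φ″ = 0`
    rw [cubicE3Deriv2_pair_eq, ← hz]; simp
  · -- `Δ_U > 0` forces `u < 1` (as `s < 1`), then divide the identity by `1 − u`
    have hX0 : secEx p e (ind U) false < 1 := by
      by_contra hc
      have : secEx p e (ind U) false = 1 := le_antisymm h01 (not_lt.1 hc)
      have hle : secEx p e (ind U) true ≤ 1 := h11
      unfold secDelta at hpos; linarith
    have hu : secM p e (ind U) s < 1 := by unfold secM; nlinarith
    have h1u : 0 < 1 - secM p e (ind U) s := sub_pos.2 hu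
    have hA : 0 ≤ 2 * secDelta p e (ind U) ^ 2 * (2 * secM p e (ind U * ind V) s - secM p e (ind U) s * secM p e (ind V) s) :=
      mul_nonneg (by positivity) huv
    have hB : 0 ≤ 2 * (1 - secM p e (ind U) s) ^ 2 * (secDelta p e (ind U) * secDelta p e (ind V)) :=
      mul_nonneg (by positivity) (mul_nonneg hΔU hΔV)
    have hprod : (1 - secM p e (ind U) s) * cubicE3Deriv2 p e (ind U) (ind U) (ind V) s ≤ 0 := by linarith
    by_contra hc
    have : 0 < (1 - secM p e (ind U) s) * cubicE3Deriv2 p e (ind U) (ind U) (ind V) s := mul_pos h1u (not_le.1 hc)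
    linarith

/-- **NIM holds at EVERY live coin of a pair triple `(U,U,V)`** (given stationarity there): in particular the NIM conclusion. [this work] -/
theorem nim_pair (p : ι → unitInterval) {U V : Set (Set ι)} (hU : IsUpperSet U) (hV : IsUpperSet V)
    {e : ι} (he : e ∈ liveSet p) (hstat : fibreSlope p e (ind U) (ind U) (ind V) = 0) :
    cubicE3Deriv2 p e (ind U) (ind U) (ind V) (p e) ≤ 0 := by
  have hlt : ((p e : unitInterval) : ℝ) < 1 := ((mem_liveSet p e).1 he).2
  rw [fibreSlope_eq] at hstat
  exact cubicE3Deriv2_nonpos_of_stationary_pair p e hU hV (p e) hlt hstat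

end SahiSliceMinimum

end Summit.CriticalPhenomena.PercolationContinuityZ3.Theorems
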